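import Literature.NumberTheory.EllipticCurves.DiscRadialVanishing
import Mathlib.MeasureTheory.Function.Jacobian
import Mathlib.RingTheory.Complex
import Literature.Analysis.Complex.LengthArea
import HarnessLib

/-!
# The Cayley transform and the vanishing of the definite-orbit integrals `∫_ℍ ψ(w)(w²+1) G((|w|²+1)/Im w) dμ(w)`

[[cite: Shintani1975, §2, proof of Prop. 2.3 (p. 103)]] — in the unfolding of Shintani's theta
lift, a positive (or negative) DEFINITE lattice vector `x`, moved by `g ∈ SL₂(ℝ)` so that its root
is `i` (`x ∘ g = λ(X² + Y²)`), contributes `λ ∫_ℍ ψ(w)(w² + 1) G((|w|² + 1)/Im w) dμ(w)` with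
`ψ = φ|₂g` holomorphic and `G` the Gaussian profile in Shintani's `p_w(x) = λ(|w|²+1)/Im w`.
Shintani shows these vanish by the rotation symmetry around the fixed point.  We PROVE the
vanishing for every holomorphic `ψ` and every radial profile `G` (under integrability), through
the disc model:

* `cayInv ζ = i(1+ζ)/(1-ζ)`, its imaginary part `(1-|ζ|²)/|1-ζ|²`, derivative `2i/(1-ζ)²`,
  injectivity, and `cayInv '' 𝔻 = {Im > 0}` (inverse `w ↦ (w-i)/(w+i)`);
* `setIntegral_uhp_eq_setIntegral_ball`, `integrableOn_uhp_iff_integrableOn_ball` — the change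
  of variables `w = cayInv ζ` with Jacobian `|2i/(1-ζ)²|²` (Mathlib
  `integral_image_eq_integral_abs_det_fderiv_smul`; `det_ℝ(z ↦ dz) = |d|²` is the tree's
  `Literature.Analysis.Complex.LengthArea.det_restrictScalars_smulRight`);
* `cayInv_sq_add_one : w² + 1 = -4ζ/(1-ζ)²`, `radial_cayInv : (|w|²+1)/Im w = 2(1+|ζ|²)/(1-|ζ|²)`,
  `disc_integrand_eq` — the transported integrand is `H(|ζ|) ζ Ψ(ζ)` with `Ψ = ψ(w) dw/dζ`
  holomorphic on `𝔻` and `H` radial;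
* **`setIntegral_uhp_definite_eq_zero`** — hence
  `∫_{Im w>0} (Im w)⁻² ψ(w)(w²+1) G((|w|²+1)/Im w) dA(w) = 0` by `DiscRadialVanishing`
  (Cauchy's theorem on the circles `|ζ| = r`).

No named facts; the only definition is `cayInv`.
-/

noncomputable section

open Complex MeasureTheory Set Filter Real
open Literature.Analysis.Complex
open scoped Topology ComplexConjugate

namespace Literature.NumberTheory.EllipticCurves.ModularForms

/-! ### The inverse Cayley map `ζ ↦ i(1+ζ)/(1-ζ)` -/

/-- The inverse Cayley transform `𝔻 → ℍ`, `ζ ↦ i (1 + ζ)/(1 - ζ)`. [folklore] -/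
def cayInv (ζ : ℂ) : ℂ := I * (1 + ζ) / (1 - ζ)

/-- `1 - ζ ≠ 0` on the unit disc. [folklore] -/
theorem one_sub_ne_zero_of_mem_ball {ζ : ℂ} (hζ : ζ ∈ Metric.ball (0 : ℂ) 1) : (1 : ℂ) - ζ ≠ 0 := by
  intro h
  have : ζ = 1 := by linear_combination -h
  rw [this, Metric.mem_ball, dist_zero_right, norm_one] at hζ
  exact lt_irrefl _ hζ

/-- `Im (i(1+ζ)/(1-ζ)) = (1 - |ζ|²)/|1 - ζ|²`. [folklore] -/
theorem cayInv_im (ζ : ℂ) (h1 : (1 : ℂ) - ζ ≠ 0) :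
    (cayInv ζ).im = (1 - ‖ζ‖ ^ 2) / ‖1 - ζ‖ ^ 2 := by
  have hns : Complex.normSq (1 - ζ) = ‖1 - ζ‖ ^ 2 := Complex.normSq_eq_norm_sq _
  rw [cayInv, Complex.div_im, hns, ← Complex.normSq_eq_norm_sq ζ, Complex.normSq_apply]
  simp only [mul_re, I_re, add_re, one_re, I_im, add_im, one_im, mul_im, sub_re, sub_im,
    zero_mul, one_mul, zero_add, zero_sub]
  field_simp
  ring

/-- `cayInv` maps the disc into the upper half-plane. [folklore] -/
theorem cayInv_im_pos {ζ : ℂ} (hζ : ζ ∈ Metric.ball (0 : ℂ) 1) : 0 < (cayInv ζ).im := by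
  rw [cayInv_im ζ (one_sub_ne_zero_of_mem_ball hζ)]
  rw [Metric.mem_ball, dist_zero_right] at hζ
  have h1 : ‖ζ‖ ^ 2 < 1 := by nlinarith [norm_nonneg ζ]
  have h2 : 0 < ‖(1 : ℂ) - ζ‖ := norm_pos_iff.mpr (one_sub_ne_zero_of_mem_ball (by
    rwa [Metric.mem_ball, dist_zero_right]))
  positivity

/-- The derivative `d/dζ [i(1+ζ)/(1-ζ)] = 2i/(1-ζ)²`. [folklore] -/
theorem hasDerivAt_cayInv {ζ : ℂ} (h1 : (1 : ℂ) - ζ ≠ 0) :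
    HasDerivAt cayInv (2 * I / (1 - ζ) ^ 2) ζ := by
  have hnum : HasDerivAt (fun ζ : ℂ ↦ I * (1 + ζ)) I ζ := by
    simpa using ((hasDerivAt_id ζ).const_add 1).const_mul I
  have hden : HasDerivAt (fun ζ : ℂ ↦ (1 : ℂ) - ζ) (-1) ζ := by
    simpa using (hasDerivAt_id ζ).const_sub 1
  have h := hnum.div hden h1
  refine (show HasDerivAt (fun ζ : ℂ ↦ I * (1 + ζ) / (1 - ζ)) _ ζ from h).congr_deriv ?_
  rw [eq_div_iff (pow_ne_zero 2 h1), div_mul_cancel₀ _ (pow_ne_zero 2 h1)]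
  ring

/-- `cayInv` is injective on the disc (indeed wherever `1 - ζ ≠ 0`). [folklore] -/
theorem injOn_cayInv : InjOn cayInv (Metric.ball (0 : ℂ) 1) := by
  intro ζ hζ ζ' hζ' h
  have h1 := one_sub_ne_zero_of_mem_ball hζ
  have h1' := one_sub_ne_zero_of_mem_ball hζ'
  unfold cayInv at h
  rw [div_eq_div_iff h1 h1'] at h
  have : I * (2 * (ζ - ζ')) = 0 := by linear_combination h
  simpa [I_ne_zero, sub_eq_zero] using this

/-- The Cayley map `w ↦ (w - i)/(w + i)` inverts `cayInv` on `Im w > 0`. [folklore] -/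
theorem cayInv_cayley {w : ℂ} (hw : 0 < w.im) : cayInv ((w - I) / (w + I)) = w := by
  have hwI : w + I ≠ 0 := by
    intro h
    have := congrArg Complex.im h
    simp at this
    linarith
  unfold cayInv
  have h2 : (1 : ℂ) - (w - I) / (w + I) = 2 * I / (w + I) := by field_simp; ring
  have h3 : (1 : ℂ) + (w - I) / (w + I) = 2 * w / (w + I) := by field_simp; ring
  rw [h2, h3]
  have hI2 : (2 : ℂ) * I ≠ 0 := mul_ne_zero two_ne_zero I_ne_zero
  field_simp

/-- The Cayley image of `Im w > 0` lies in the disc: `|w - i| < |w + i|`. [folklore] -/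
theorem cayley_mem_ball {w : ℂ} (hw : 0 < w.im) : (w - I) / (w + I) ∈ Metric.ball (0 : ℂ) 1 := by
  have hwI : w + I ≠ 0 := by
    intro h
    have := congrArg Complex.im h
    simp at this
    linarith
  rw [Metric.mem_ball, dist_zero_right, norm_div, div_lt_one (norm_pos_iff.mpr hwI)]
  have h1 : ‖w - I‖ ^ 2 < ‖w + I‖ ^ 2 := by
    rw [← Complex.normSq_eq_norm_sq, ← Complex.normSq_eq_norm_sq, Complex.normSq_apply,
      Complex.normSq_apply]
    simp only [sub_re, I_re, sub_zero, sub_im, I_im, add_re, add_zero, add_im]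
    nlinarith
  exact lt_of_pow_lt_pow_left₀ 2 (norm_nonneg _) h1

/-- **`cayInv '' 𝔻 = ℍ`.** [folklore] -/
theorem image_cayInv_ball : cayInv '' Metric.ball (0 : ℂ) 1 = {z : ℂ | 0 < z.im} := by
  ext z
  constructor
  · rintro ⟨ζ, hζ, rfl⟩
    exact cayInv_im_pos hζ
  · intro hz
    exact ⟨(z - I) / (z + I), cayley_mem_ball hz, cayInv_cayley hz⟩

/-! ### Change of variables `w = cayInv ζ` -/

/-- **Change of variables to the disc**: for any `F : ℂ → ℂ`,
`∫_{Im w > 0} F(w) dA(w) = ∫_{|ζ|<1} |2/(1-ζ)²|² F(cayInv ζ) dA(ζ)`. [folklore] -/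
theorem setIntegral_uhp_eq_setIntegral_ball (F : ℂ → ℂ) :
    ∫ z in {z : ℂ | 0 < z.im}, F z =
      ∫ ζ in Metric.ball (0 : ℂ) 1, (‖2 * I / (1 - ζ) ^ 2‖ ^ 2 : ℝ) • F (cayInv ζ) := by
  rw [← image_cayInv_ball]
  rw [integral_image_eq_integral_abs_det_fderiv_smul volume Metric.isOpen_ball.measurableSet
    (f' := fun ζ ↦ (ContinuousLinearMap.smulRight (1 : ℂ →L[ℂ] ℂ) (2 * I / (1 - ζ) ^ 2)).restrictScalars ℝ)
    (fun ζ hζ ↦ ((hasDerivAt_cayInv (one_sub_ne_zero_of_mem_ball hζ)).hasFDerivAt.restrictScalars ℝ).hasFDerivWithinAt)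
    injOn_cayInv]
  refine setIntegral_congr_fun Metric.isOpen_ball.measurableSet fun ζ _ ↦ ?_
  rw [LengthArea.det_restrictScalars_smulRight, abs_of_nonneg (sq_nonneg _)]

/-- Integrability transfers along the same change of variables. [folklore] -/
theorem integrableOn_uhp_iff_integrableOn_ball (F : ℂ → ℂ) :
    IntegrableOn F {z : ℂ | 0 < z.im} ↔
      IntegrableOn (fun ζ ↦ (‖2 * I / (1 - ζ) ^ 2‖ ^ 2 : ℝ) • F (cayInv ζ)) (Metric.ball (0 : ℂ) 1) := by
  rw [← image_cayInv_ball]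
  rw [integrableOn_image_iff_integrableOn_abs_det_fderiv_smul volume Metric.isOpen_ball.measurableSet
    (f' := fun ζ ↦ (ContinuousLinearMap.smulRight (1 : ℂ →L[ℂ] ℂ) (2 * I / (1 - ζ) ^ 2)).restrictScalars ℝ)
    (fun ζ hζ ↦ ((hasDerivAt_cayInv (one_sub_ne_zero_of_mem_ball hζ)).hasFDerivAt.restrictScalars ℝ).hasFDerivWithinAt)
    injOn_cayInv]
  refine integrableOn_congr_fun (fun ζ _ ↦ ?_) Metric.isOpen_ball.measurableSet
  rw [LengthArea.det_restrictScalars_smulRight, abs_of_nonneg (sq_nonneg _)]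

/-! ### The geometric identities -/

/-- `(cayInv ζ)² + 1 = -4ζ/(1-ζ)²`. [folklore] -/
theorem cayInv_sq_add_one {ζ : ℂ} (h1 : (1 : ℂ) - ζ ≠ 0) :
    cayInv ζ ^ 2 + 1 = -4 * ζ / (1 - ζ) ^ 2 := by
  unfold cayInv
  field_simp
  ring_nf
  simp only [Complex.I_sq]
  ring

/-- `|cayInv ζ|² + 1 = 2(1 + |ζ|²)/|1-ζ|²`. [folklore] -/
theorem normSq_cayInv_add_one {ζ : ℂ} (h1 : (1 : ℂ) - ζ ≠ 0) :
    Complex.normSq (cayInv ζ) + 1 = 2 * (1 + ‖ζ‖ ^ 2) / ‖1 - ζ‖ ^ 2 := by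
  have hn : ‖(1 : ℂ) - ζ‖ ^ 2 ≠ 0 := pow_ne_zero 2 (norm_ne_zero_iff.mpr h1)
  rw [cayInv, Complex.normSq_div, Complex.normSq_mul, Complex.normSq_I, one_mul,
    Complex.normSq_eq_norm_sq (1 - ζ), ← Complex.normSq_eq_norm_sq ζ]
  rw [eq_div_iff hn, add_mul, div_mul_cancel₀ _ hn, one_mul]
  rw [← Complex.normSq_eq_norm_sq, Complex.normSq_apply, Complex.normSq_apply, Complex.normSq_apply]
  simp only [add_re, one_re, add_im, one_im, sub_re, sub_im, zero_add, zero_sub]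
  ring

/-- The radial invariant: `(|w|² + 1)/Im w = 2(1+|ζ|²)/(1-|ζ|²)` at `w = cayInv ζ`. [folklore] -/
theorem radial_cayInv {ζ : ℂ} (hζ : ζ ∈ Metric.ball (0 : ℂ) 1) :
    (Complex.normSq (cayInv ζ) + 1) / (cayInv ζ).im = 2 * (1 + ‖ζ‖ ^ 2) / (1 - ‖ζ‖ ^ 2) := by
  have h1 := one_sub_ne_zero_of_mem_ball hζ
  have hn : ‖(1 : ℂ) - ζ‖ ^ 2 ≠ 0 := pow_ne_zero 2 (norm_ne_zero_iff.mpr h1)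
  have hr : 1 - ‖ζ‖ ^ 2 ≠ 0 := by
    rw [Metric.mem_ball, dist_zero_right] at hζ
    nlinarith [norm_nonneg ζ]
  rw [normSq_cayInv_add_one h1, cayInv_im ζ h1]
  field_simp

/-! ### The vanishing -/

/-- **The integrand on the disc**: with `w = cayInv ζ`, `Ψ(ζ) = ψ(w) · 2i/(1-ζ)²`,
`|2i/(1-ζ)²|² · (Im w)⁻² ψ(w)(w²+1) G((|w|²+1)/Im w) = H(|ζ|) ζ Ψ(ζ)` with
`H(r) = 8i G(2(1+r²)/(1-r²))/(1-r²)²`. [folklore] -/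
theorem disc_integrand_eq (ψ : ℂ → ℂ) (G : ℝ → ℂ) {ζ : ℂ} (hζ : ζ ∈ Metric.ball (0 : ℂ) 1) :
    (‖2 * I / (1 - ζ) ^ 2‖ ^ 2 : ℝ) •
        (((1 / (cayInv ζ).im ^ 2 : ℝ) : ℂ) * (ψ (cayInv ζ) * (cayInv ζ ^ 2 + 1) *
          G ((Complex.normSq (cayInv ζ) + 1) / (cayInv ζ).im))) =
      (-8 * G (2 * (1 + ‖ζ‖ ^ 2) / (1 - ‖ζ‖ ^ 2)) / (((1 - ‖ζ‖ ^ 2) ^ 2 : ℝ) : ℂ) / I) *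
        (ζ * (ψ (cayInv ζ) * (2 * I / (1 - ζ) ^ 2))) := by
  have h1 := one_sub_ne_zero_of_mem_ball hζ
  have hr : (1 : ℝ) - ‖ζ‖ ^ 2 ≠ 0 := by
    rw [Metric.mem_ball, dist_zero_right] at hζ
    nlinarith [norm_nonneg ζ]
  have hrC : ((1 - ‖ζ‖ ^ 2 : ℝ) : ℂ) ≠ 0 := Complex.ofReal_ne_zero.mpr hr
  have hn0 : ((‖(1 : ℂ) - ζ‖ : ℝ) : ℂ) ≠ 0 := by exact_mod_cast norm_ne_zero_iff.mpr h1
  have hz2 : ((1 : ℂ) - ζ) ^ 2 ≠ 0 := pow_ne_zero 2 h1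
  rw [radial_cayInv hζ, cayInv_sq_add_one h1, cayInv_im ζ h1, Complex.real_smul]
  -- `|2i/(1-ζ)²|² = 4/|1-ζ|⁴`
  have hJ : (‖2 * I / (1 - ζ) ^ 2‖ ^ 2 : ℝ) = 4 / (‖1 - ζ‖ ^ 2) ^ 2 := by
    rw [norm_div, norm_mul, Complex.norm_ofNat, Complex.norm_I, mul_one, norm_pow]; ring
  rw [hJ]
  push_cast
  field_simp
  ring

/-- **Vanishing of the definite-orbit integral on the upper half-plane** (as an integral over
`{Im z > 0} ⊆ ℂ` against `(Im z)⁻² dA`): for `ψ` holomorphic on `Im z > 0` and any radial profile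
`G`, if the integrand is integrable then
`∫_{Im w>0} (Im w)⁻² ψ(w) (w² + 1) G((|w|²+1)/Im w) dA(w) = 0`.
[cite: Shintani1975, §2, proof of Prop. 2.3 (p. 103)] -/
theorem setIntegral_uhp_definite_eq_zero {ψ : ℂ → ℂ} (hψ : DifferentiableOn ℂ ψ {z : ℂ | 0 < z.im})
    (G : ℝ → ℂ)
    (hint : IntegrableOn (fun p : ℝ × ℝ ↦ (p.1 : ℂ) *
      ((-8 * G (2 * (1 + p.1 ^ 2) / (1 - p.1 ^ 2)) / (((1 - p.1 ^ 2) ^ 2 : ℝ) : ℂ) / I) *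
        (circleMap 0 p.1 p.2 * (ψ (cayInv (circleMap 0 p.1 p.2)) *
          (2 * I / (1 - circleMap 0 p.1 p.2) ^ 2))))) (Ioo (0 : ℝ) 1 ×ˢ Ioo (-π) π)) :
    ∫ z in {z : ℂ | 0 < z.im}, ((1 / z.im ^ 2 : ℝ) : ℂ) * (ψ z * (z ^ 2 + 1) *
      G ((Complex.normSq z + 1) / z.im)) = 0 := by
  rw [setIntegral_uhp_eq_setIntegral_ball]
  set H : ℝ → ℂ := fun r ↦ -8 * G (2 * (1 + r ^ 2) / (1 - r ^ 2)) / (((1 - r ^ 2) ^ 2 : ℝ) : ℂ) / I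
    with hH
  set Ψ : ℂ → ℂ := fun ζ ↦ ψ (cayInv ζ) * (2 * I / (1 - ζ) ^ 2) with hΨ
  have hcongr : ∫ ζ in Metric.ball (0 : ℂ) 1, (‖2 * I / (1 - ζ) ^ 2‖ ^ 2 : ℝ) •
      (((1 / (cayInv ζ).im ^ 2 : ℝ) : ℂ) * (ψ (cayInv ζ) * (cayInv ζ ^ 2 + 1) *
        G ((Complex.normSq (cayInv ζ) + 1) / (cayInv ζ).im))) =
      ∫ ζ in Metric.ball (0 : ℂ) 1, H ‖ζ‖ * (ζ * Ψ ζ) :=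
    setIntegral_congr_fun Metric.isOpen_ball.measurableSet fun ζ hζ ↦ by
      rw [hH, hΨ]; exact disc_integrand_eq ψ G hζ
  rw [hcongr]
  refine integral_ball_radial_mul_eq_zero ?_ H ?_
  · -- `Ψ = (ψ ∘ cayInv) · 2i/(1-ζ)²` is holomorphic on the disc
    intro ζ hζ
    have h1 := one_sub_ne_zero_of_mem_ball hζ
    have hc : DifferentiableWithinAt ℂ cayInv (Metric.ball 0 1) ζ :=
      (hasDerivAt_cayInv h1).differentiableAt.differentiableWithinAt
    have hcomp : DifferentiableWithinAt ℂ (fun ζ ↦ ψ (cayInv ζ)) (Metric.ball 0 1) ζ :=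
      (hψ _ (cayInv_im_pos hζ)).comp ζ hc (fun ζ' hζ' ↦ cayInv_im_pos hζ')
    have hfac : DifferentiableAt ℂ (fun ζ : ℂ ↦ 2 * I / (1 - ζ) ^ 2) ζ :=
      (differentiableAt_const _).div (((differentiableAt_const _).sub differentiableAt_id).pow 2)
        (pow_ne_zero 2 h1)
    exact hcomp.mul hfac.differentiableWithinAt
  · simpa [hH, hΨ] using hint

end Literature.NumberTheory.EllipticCurves.ModularForms
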